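import Literature.NumberTheory.Rogawski1990.ArchEndoscopicAtlasNormPair   -- ★ LH3-p04 (g2) (I₁-Δ-S) PART 2a: the norm pair `endoTorus S c ↔ gprimeTorus α S (c∘ρ)`; brings PART 1 (Laurent form of `τ·D`)
import HarnessLib

/-!
# (I₁-Δ-S) PART 2b: the κ-table and `Δ″` on the GENERAL Cartan atlas chart (`S ⊆ splitChartPlaces` arbitrary) — `Δ″(endoTorus S c, gprimeTorus α S (c∘ρ)) = K^S_ρ · (τ·D_{G∕H,∞})(endoTorus S c)`
# (Rogawski 1990 §4.9 p. 55, §14.6 p. 242, §8.2 pp. 119–123; Langlands–Shelstad 1987 §2.4; Knapp 1986 Ch. V §3)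

Topic `NumberTheory/Rogawski1990`; namespace `Literature.NumberTheory.Rogawski1990`.  THEOREMS ONLY (no `def`, no instance, no notation, no axiom, no named fact, no `sorry`).
Cell `pub/hodgecm-mathlib`, line LH3 (closer stub `stub_N9`, crux H413 = `stmt-HodgeConjecture-24833`), DIRECT ROAD organ **(I₁-Δ-S)** PART 2b (companion of ★ `ArchExplicitTransferFactorAtlas`,
which reads the compact chart `S = ∅` through `slotPerm`; here `S` is arbitrary and the relabelling is a raw `ρ : W → S₃`) = the general-chart edition of
★ p849548 §2–§3 ((κ-TABLE) + (Δ-def-explicit)): house frame `H′ = diagonal α`, `S ⊆ splitChartPlaces L α`, relabelling `ρ` of the compact places (`ρ_w = 1` on `S`),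
`τ_w = lineOf (formSign L α w)` the slot-to-line map of ★ (T-ATLAS) PART 2a.

THE MATHEMATICS.  Let `E_w` be the eigenvalue triple (PART 1: `boostEig (c w)` at `w ∈ S`, `(e^{i c_w ·})` at `w ∉ S`), `q_w = (E_w1 − E_w0)(E_w1 − E_w2)`.
THE EIGENLINE POLYNOMIAL `P_w = χ_{g_w}(γ′_w)` of the chart partner is `diag(ℓ ↦ [ρ_w(τ_w⁻¹ ℓ) = 1]·q_w)` IN BOTH CHARTS: at a compact place `γ′_w = diag(ℓ ↦ E_w(ρ_w(τ_w⁻¹ ℓ)))` and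
`χ_g(E_k) = [k = 1]·q` slot by slot; at a split place `γ′_w = P_τ·cayB·diag(E_w)·cayB⁻¹·P_τ⁻¹` (★ `boostStd_eq_conj_diagonal`), `χ_g` commutes with conjugation,
`χ_g(diag E_w) = diag(0, q_w, 0)` COMMUTES WITH `cayB` (whose middle row and column are `e₁`), and re-indexing by `τ` moves the entry `q_w` to the line `τ_w 1` — the boost's
`u`-eigenline is the SECOND EVEN-SIGN LINE.  Hence `κ_w = sgn(re σ_w α_{τ_w(ρ_w⁻¹ 1)})·η_w` off `q_w = 0` (`= majority sign · η_w` at every split place), `0` at `q_w = 0`, and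
`Δ″ = K^S_ρ · τ·D` with `K^S_ρ = Π_w sgn(re σ_w α_{τ_w(ρ_w⁻¹ 1)})·η_w` a constant — times PART 1's Laurent polynomial under the μ-guard.

WHAT IS PROVED.  `archEigenlineProjector_atlas` (both charts), `archKappaAt_atlas_eq_of_ne_zero ∕ _eq_zero`, **`archExplicitDelta_atlas_eq_mul`** (`Δ″ = K^S_ρ·(τ·D)`, all `c`),
**`exists_archExplicitDelta_atlas_eq_prod`** (`Δ″ = K^S_ρ · Π_w −((E_w0E_w2)^{k_w}(E_w1−E_w0)(E_w1−E_w2))∕E_w1` under `hμω`).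
HONEST LABEL: HC_CM is proved only modulo the 7 printed citations (2 remaining: hLiu418 = stmt-HodgeConjecture-24832, h413 = stmt-HodgeConjecture-24833) until rung 0 closes; this closes
organ (I₁-Δ-S) of `stub_N9`'s direct road (the `δ_ρ(c)` of D2′-SPEC §3b in closed form) and pays nothing by itself.

## References
* [Rogawski1990] J. D. Rogawski, *Automorphic Representations of Unitary Groups in Three Variables*, Ann. of Math. Stud. 123 (1990), §4.9 p. 55, §14.6 p. 242, §8.2 pp. 119–123.
* [LanglandsShelstad1987] R. P. Langlands, D. Shelstad, *On the definition of transfer factors*, Math. Ann. 278 (1987), §2.4, Lemma 4.1.A.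
* [Knapp1986] A. W. Knapp, *Representation Theory of Semisimple Groups* (1986), Ch. V §3.
-/

set_option autoImplicit false

noncomputable section

open NumberField NumberField.InfinitePlace Complex Equiv
open scoped MatrixGroups ComplexConjugate Classical
open Literature.NumberTheory.Automorphic Literature.NumberTheory.Automorphic.UnitaryGroup Literature.NumberTheory.GaloisRepresentations
open Literature.LinearAlgebra.Matrix

namespace Literature.NumberTheory.Rogawski1990

/-! ## §0 Scalar and matrix algebra (private) -/

/-- `sgn(|q|²·r) = sgn r` for `q ≠ 0`. [folklore] -/
private theorem sign_normSq_mul₃ {q : ℂ} (hq : q ≠ 0) (r : ℝ) : SignType.sign (Complex.normSq q * r) = SignType.sign r := by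
  rw [sign_mul, (sign_pos (Complex.normSq_pos.mpr hq) : SignType.sign (Complex.normSq q) = 1), one_mul]

/-- `χ_g(E_k) = [k = 1]·(E₁ − E₀)(E₁ − E₂)` slot by slot (`tr g = E₀ + E₂`, `det g = E₀E₂`). [folklore] -/
private theorem charpoly_triple_slot (E : Fin 3 → ℂ) (k : Fin 3) :
    E k * E k - (E 0 + E 2) * E k + E 0 * E 2 = if k = 1 then (E 1 - E 0) * (E 1 - E 2) else 0 := by
  fin_cases k <;> simp <;> ring

/-- The polynomial `X² − t·X + d` commutes with re-indexing along an equivalence. [folklore] -/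
private theorem poly_submatrix (M : Matrix (Fin 3) (Fin 3) ℂ) (e : Fin 3 ≃ Fin 3) (t d : ℂ) :
    M.submatrix e e * M.submatrix e e - t • M.submatrix e e + d • (1 : Matrix (Fin 3) (Fin 3) ℂ) =
      (M * M - t • M + d • (1 : Matrix (Fin 3) (Fin 3) ℂ)).submatrix e e := by
  rw [Matrix.submatrix_mul_equiv, Matrix.submatrix_add, Matrix.submatrix_sub, Matrix.submatrix_smul, Matrix.submatrix_smul]
  simp only [Pi.add_apply, Pi.sub_apply, Pi.smul_apply, Matrix.submatrix_one_equiv]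

/-- The polynomial `X² − t·X + d` commutes with conjugation by an invertible matrix. [folklore] -/
private theorem poly_conj (C D : Matrix (Fin 3) (Fin 3) ℂ) (hC : IsUnit C.det) (t d : ℂ) :
    C * D * C⁻¹ * (C * D * C⁻¹) - t • (C * D * C⁻¹) + d • (1 : Matrix (Fin 3) (Fin 3) ℂ) = C * (D * D - t • D + d • (1 : Matrix (Fin 3) (Fin 3) ℂ)) * C⁻¹ := by
  have h1 : C * D * C⁻¹ * (C * D * C⁻¹) = C * (D * D) * C⁻¹ := by
    rw [show C * D * C⁻¹ * (C * D * C⁻¹) = C * D * (C⁻¹ * C) * D * C⁻¹ by simp only [Matrix.mul_assoc], Matrix.nonsing_inv_mul _ hC, Matrix.mul_one,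
      Matrix.mul_assoc C D D]
  rw [h1]
  simp only [Matrix.mul_add, Matrix.mul_sub, Matrix.add_mul, Matrix.sub_mul, Matrix.mul_smul, Matrix.smul_mul, Matrix.mul_one, Matrix.mul_nonsing_inv _ hC]

/-- `cayB b` commutes with `diag(0, q, 0)` (its middle row and column are `e₁`). [cite: Knapp1986, Ch. V §3] -/
private theorem cayB_mul_diagonal_single_one (b : Fin 3 → ℝ) (q : ℂ) :
    cayB b * Matrix.diagonal (fun k : Fin 3 => if k = 1 then q else 0) = Matrix.diagonal (fun k : Fin 3 => if k = 1 then q else 0) * cayB b := by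
  ext i j
  fin_cases i <;> fin_cases j <;> simp [cayB, Matrix.mul_apply, Matrix.diagonal]

section Atlas

variable (L : Type) [Field L] [NumberField L] [IsCMField L] (α : Fin 3 → L) (μ : HeckeCharacter L)
  (S : Finset {w : InfinitePlace L // IsComplex w}) (c : {w : InfinitePlace L // IsComplex w} → Fin 3 → ℝ) (w : {w : InfinitePlace L // IsComplex w})

/-! ## §1 The trace and determinant of the 2-block, the partner matrix -/

/-- `tr σ_w(g) = E_w0 + E_w2`, `det σ_w(g) = E_w0·E_w2` for the 2-block `g` of `endoTorus S c` (both charts). [cite: Rogawski1990, §3.6 p. 31; §8.2 p. 122] -/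
private theorem trace_det_fst_endoTorus :
    (((((endoTorus L S c).1 : ↥(UnitaryGroup.arch (↥(maximalRealSubfield L)) L (IsCMField.complexConj L) 2
        (Matrix.of fun i j : Fin 2 => if i.val + j.val + 1 = 2 then (1 : L) else 0))) : GL (Fin 2) (mixedEmbedding.mixedSpace L)) :
          Matrix (Fin 2) (Fin 2) (mixedEmbedding.mixedSpace L)).map (UnitaryGroup.evalC L w)).trace =
        (if w ∈ S then boostEig (c w) else fun i => (Circle.exp (c w i) : ℂ)) 0 + (if w ∈ S then boostEig (c w) else fun i => (Circle.exp (c w i) : ℂ)) 2 ∧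
    (((((endoTorus L S c).1 : ↥(UnitaryGroup.arch (↥(maximalRealSubfield L)) L (IsCMField.complexConj L) 2
        (Matrix.of fun i j : Fin 2 => if i.val + j.val + 1 = 2 then (1 : L) else 0))) : GL (Fin 2) (mixedEmbedding.mixedSpace L)) :
          Matrix (Fin 2) (Fin 2) (mixedEmbedding.mixedSpace L)).map (UnitaryGroup.evalC L w)).det =
        (if w ∈ S then boostEig (c w) else fun i => (Circle.exp (c w i) : ℂ)) 0 * (if w ∈ S then boostEig (c w) else fun i => (Circle.exp (c w i) : ℂ)) 2 := by
  have h := congrArg (fun g : GL (Fin 2) ℂ => (g : Matrix (Fin 2) (Fin 2) ℂ)) (map_evalC_fst_endoTorus L S c w)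
  have h' : ((((endoTorus L S c).1 : ↥(UnitaryGroup.arch (↥(maximalRealSubfield L)) L (IsCMField.complexConj L) 2
        (Matrix.of fun i j : Fin 2 => if i.val + j.val + 1 = 2 then (1 : L) else 0))) : GL (Fin 2) (mixedEmbedding.mixedSpace L)) :
          Matrix (Fin 2) (Fin 2) (mixedEmbedding.mixedSpace L)).map (UnitaryGroup.evalC L w) =
      ((endoBlock L S c w : ↥(archLocal L 2 (Matrix.of fun i j : Fin 2 => if i.val + j.val + 1 = 2 then (1 : L) else 0) w)) : GL (Fin 2) ℂ) :=
    (Eq.trans rfl h : _)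
  rw [h']
  by_cases hw : w ∈ S
  · rw [coe_endoBlock_of_mem L c hw, if_pos hw, Matrix.trace_fin_two_of, Matrix.det_fin_two_of]
    simp [boostEig]
  · rw [coe_endoBlock_of_not_mem L c hw, if_neg hw, Matrix.trace_fin_two_of, Matrix.det_fin_two_of]
    constructor <;> ring

/-- The `w`-matrix of the chart partner `gprimeTorus α S c′`: the matrix of `gprimeBlock α w S c′`. [cite: Rogawski1990, §3.6 p. 31] -/
private theorem coe_map_evalC_gprimeTorus (c' : {w : InfinitePlace L // IsComplex w} → Fin 3 → ℝ) :
    ((((gprimeTorus L α S c' : ↥(UnitaryGroup.arch (↥(maximalRealSubfield L)) L (IsCMField.complexConj L) 3 (Matrix.diagonal α))) :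
        GL (Fin 3) (mixedEmbedding.mixedSpace L)) : Matrix (Fin 3) (Fin 3) (mixedEmbedding.mixedSpace L)).map (UnitaryGroup.evalC L w)) =
      (((gprimeBlock L α w S c' : ↥(archLocal L 3 (Matrix.diagonal α) w)) : GL (Fin 3) ℂ) : Matrix (Fin 3) (Fin 3) ℂ) := by
  have h := congrArg (fun g : GL (Fin 3) ℂ => (g : Matrix (Fin 3) (Fin 3) ℂ)) (map_evalC_gprimeTorus L α S c' w)
  exact (Eq.trans rfl h : _)

/-! ## §2 The eigenline polynomial of the chart partner, both charts -/

variable {S} in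
/-- **THE EIGENLINE POLYNOMIAL ON THE ATLAS**: `P_w(endoTorus S c, gprimeTorus α S (c∘ρ)) = diag(ℓ ↦ [ρ_w(τ_w⁻¹ ℓ) = 1]·q_w)`, `q_w = (E_w1 − E_w0)(E_w1 − E_w2)`,
`τ_w = lineOf (formSign L α w)`, in BOTH charts (`S ⊆ splitChartPlaces`, `ρ_w = 1` on `S`): at a split place the boost's `u`-eigenline is the coordinate line `τ_w 1`.
[cite: Rogawski1990, §14.6 p. 242; §4.9 p. 55] [cite: Knapp1986, Ch. V §3] -/
theorem archEigenlineProjector_atlas (hS : ∀ w ∈ S, w ∈ splitChartPlaces L α)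
    (ρ : {w : InfinitePlace L // IsComplex w} → Perm (Fin 3)) (hρ : ∀ w ∈ S, ρ w = 1) :
    archEigenlineProjector L (Matrix.diagonal α) (endoTorus L S c) w (gprimeTorus L α S fun v => c v ∘ ⇑(ρ v)) =
      Matrix.diagonal fun ℓ => if ρ w ((lineOf (formSign L α w)).symm ℓ) = 1 then
        (((if w ∈ S then boostEig (c w) else fun i => (Circle.exp (c w i) : ℂ)) 1) - ((if w ∈ S then boostEig (c w) else fun i => (Circle.exp (c w i) : ℂ)) 0)) *
          (((if w ∈ S then boostEig (c w) else fun i => (Circle.exp (c w i) : ℂ)) 1) - ((if w ∈ S then boostEig (c w) else fun i => (Circle.exp (c w i) : ℂ)) 2)) else 0 := by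
  obtain ⟨htr, hdet⟩ := trace_det_fst_endoTorus L S c w
  set E : Fin 3 → ℂ := if w ∈ S then boostEig (c w) else fun i => (Circle.exp (c w i) : ℂ) with hE
  unfold archEigenlineProjector
  simp only []
  rw [htr, hdet, coe_map_evalC_gprimeTorus L α S w]
  by_cases hw : w ∈ S
  · -- SPLIT PLACE: the boost, conjugate to `diag(E_w)` by `P_τ · cayB`
    have hsp := hS w hw
    have hc : (fun v => c v ∘ ⇑(ρ v)) w = c w := by simp only [hρ w hw, Equiv.Perm.coe_one, Function.comp_id]
    rw [show gprimeBlock L α w S (fun v => c v ∘ ⇑(ρ v)) = gprimeBlock L α w S c from by unfold gprimeBlock; simp only [hc],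
      coe_gprimeBlock_of_mem L α c hw hsp, coe_gprimeSplitGL]
    unfold gprimeSplitMatrix
    have hb : (formRe L α w ∘ ⇑(lineOf (formSign L α w))) 0 * (formRe L α w ∘ ⇑(lineOf (formSign L α w))) 2 < 0 := hsp.2
    have hCu : IsUnit (cayB (formRe L α w ∘ ⇑(lineOf (formSign L α w)))).det := (det_cayB_ne_zero hb).isUnit
    rw [poly_submatrix, boostStd_eq_conj_diagonal hb (c w), poly_conj _ _ hCu]
    have hD : Matrix.diagonal (boostEig (c w)) * Matrix.diagonal (boostEig (c w)) - (E 0 + E 2) • Matrix.diagonal (boostEig (c w)) +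
        (E 0 * E 2) • (1 : Matrix (Fin 3) (Fin 3) ℂ) = Matrix.diagonal fun k : Fin 3 => if k = 1 then (E 1 - E 0) * (E 1 - E 2) else 0 := by
      have hEw : E = boostEig (c w) := by rw [hE, if_pos hw]
      rw [← hEw]
      ext i j
      simp only [Matrix.sub_apply, Matrix.add_apply, Matrix.smul_apply, Matrix.diagonal_mul_diagonal, Matrix.diagonal_apply, Matrix.one_apply, smul_eq_mul]
      by_cases hij : i = j
      · subst hij
        simp only [if_true, mul_one]
        exact charpoly_triple_slot E i
      · simp [hij]
    rw [hD, cayB_mul_diagonal_single_one, Matrix.mul_nonsing_inv_cancel_right _ _ hCu, Matrix.submatrix_diagonal_equiv]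
    congr 1
    funext ℓ
    simp only [Function.comp_apply, hρ w hw, Equiv.Perm.coe_one, id]
  · -- COMPACT PLACE: the relabelled diagonal
    rw [coe_gprimeBlock_of_not_mem L α _ hw, coe_gprimeCptGL]
    have hEw : ∀ k, Complex.exp ((((fun v => c v ∘ ⇑(ρ v)) w) ((lineOf (formSign L α w)).symm k) : ℂ) * I) = E (ρ w ((lineOf (formSign L α w)).symm k)) := by
      intro k
      rw [hE, if_neg hw]
      simp only [Function.comp_apply, Circle.coe_exp]
    simp_rw [hEw]
    rw [Matrix.diagonal_mul_diagonal]
    ext i j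
    simp only [Matrix.sub_apply, Matrix.add_apply, Matrix.smul_apply, Matrix.diagonal_apply, Matrix.one_apply, smul_eq_mul]
    by_cases hij : i = j
    · subst hij
      simp only [if_true, mul_one]
      exact charpoly_triple_slot E _
    · simp [hij]

/-! ## §3 The κ-table on the atlas -/

variable {S} in
/-- **(κ-TABLE ON THE ATLAS) OFF THE WALLS: `κ_w(endoTorus S c, gprimeTorus α S (c∘ρ)) = sgn(re σ_w α_{τ_w(ρ_w⁻¹ 1)})·η_w` whenever `q_w ≠ 0`** — the sign of the form on the
line carrying the 1-block eigenvalue `u = e^{i c_w 1}` (at a split place: the second even-sign line `τ_w 1`), times the majority sign.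
[cite: Rogawski1990, §14.6 p. 242] [cite: LanglandsShelstad1987, §2, Lemma 4.1.A] -/
theorem archKappaAt_atlas_eq_of_ne_zero (hS : ∀ w ∈ S, w ∈ splitChartPlaces L α)
    (ρ : {w : InfinitePlace L // IsComplex w} → Perm (Fin 3)) (hρ : ∀ w ∈ S, ρ w = 1)
    (hq : (((if w ∈ S then boostEig (c w) else fun i => (Circle.exp (c w i) : ℂ)) 1) - ((if w ∈ S then boostEig (c w) else fun i => (Circle.exp (c w i) : ℂ)) 0)) *
          (((if w ∈ S then boostEig (c w) else fun i => (Circle.exp (c w i) : ℂ)) 1) - ((if w ∈ S then boostEig (c w) else fun i => (Circle.exp (c w i) : ℂ)) 2)) ≠ 0) :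
    archKappaAt L (Matrix.diagonal α) (endoTorus L S c) w (gprimeTorus L α S fun v => c v ∘ ⇑(ρ v)) =
      (SignType.sign ((w.1.embedding (α (lineOf (formSign L α w) ((ρ w).symm 1)))).re) : ℤ) * archMajoritySign L (Matrix.diagonal α) w := by
  unfold archKappaAt
  rw [archEigenlineProjector_atlas L α c w hS ρ hρ]
  set q : ℂ := (((if w ∈ S then boostEig (c w) else fun i => (Circle.exp (c w i) : ℂ)) 1) - ((if w ∈ S then boostEig (c w) else fun i => (Circle.exp (c w i) : ℂ)) 0)) *
          (((if w ∈ S then boostEig (c w) else fun i => (Circle.exp (c w i) : ℂ)) 1) - ((if w ∈ S then boostEig (c w) else fun i => (Circle.exp (c w i) : ℂ)) 2)) with hqdef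
  set τ : Perm (Fin 3) := lineOf (formSign L α w) with hτ
  rw [Matrix.diagonal_map (map_zero _), Matrix.diagonal_conjTranspose, Matrix.diagonal_mul_diagonal, Matrix.diagonal_mul_diagonal, Matrix.trace_diagonal]
  congr 2
  rw [Finset.sum_eq_single (τ ((ρ w).symm 1))]
  · simp only [Pi.star_apply, Equiv.symm_apply_apply, Equiv.apply_symm_apply, if_true]
    have h : star q * w.1.embedding (α (τ ((ρ w).symm 1))) * q = w.1.embedding (α (τ ((ρ w).symm 1))) * (Complex.normSq q : ℂ) := by
      rw [Complex.star_def, ← Complex.mul_conj]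
      ring
    rw [h, mul_comm, Complex.re_ofReal_mul, sign_normSq_mul₃ hq]
  · intro i _ hi
    have hne : ρ w (τ.symm i) ≠ 1 := fun h => hi (by rw [← h, Equiv.symm_apply_apply, Equiv.apply_symm_apply])
    simp only [Pi.star_apply, hne, if_false, star_zero, zero_mul]
  · intro h; exact absurd (Finset.mem_univ _) h

variable {S} in
/-- **(κ-TABLE ON THE ATLAS) AT THE WALLS `q_w = 0`: `κ_w = 0`** (harmless: `D_{G∕H,∞} = 0` there). [cite: Rogawski1990, §14.6 p. 242] -/
theorem archKappaAt_atlas_eq_zero (hS : ∀ w ∈ S, w ∈ splitChartPlaces L α)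
    (ρ : {w : InfinitePlace L // IsComplex w} → Perm (Fin 3)) (hρ : ∀ w ∈ S, ρ w = 1)
    (hq : (((if w ∈ S then boostEig (c w) else fun i => (Circle.exp (c w i) : ℂ)) 1) - ((if w ∈ S then boostEig (c w) else fun i => (Circle.exp (c w i) : ℂ)) 0)) *
          (((if w ∈ S then boostEig (c w) else fun i => (Circle.exp (c w i) : ℂ)) 1) - ((if w ∈ S then boostEig (c w) else fun i => (Circle.exp (c w i) : ℂ)) 2)) = 0) :
    archKappaAt L (Matrix.diagonal α) (endoTorus L S c) w (gprimeTorus L α S fun v => c v ∘ ⇑(ρ v)) = 0 := by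
  unfold archKappaAt
  rw [archEigenlineProjector_atlas L α c w hS ρ hρ, hq]
  have h0 : (Matrix.diagonal fun ℓ : Fin 3 => if ρ w ((lineOf (formSign L α w)).symm ℓ) = 1 then (0 : ℂ) else 0) = 0 := by
    ext i j; simp [Matrix.diagonal_apply]
  rw [h0, Matrix.mul_zero, Matrix.trace_zero, Complex.zero_re, sign_zero, SignType.coe_zero, zero_mul]

/-! ## §4 `Δ″` on the atlas -/

variable {S} in
/-- **(Δ-def-explicit ON THE ATLAS) `Δ″(endoTorus S c, gprimeTorus α S (c∘ρ)) = K^S_ρ · τ(endoTorus S c) · D_{G∕H,∞}(endoTorus S c)` FOR ALL `c`**,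
`K^S_ρ := Π_w sgn(re σ_w α_{τ_w(ρ_w⁻¹ 1)})·η_w` (a constant): the pair matches (PART 2a), `Δ″ = τ·D·Π_w κ_w`, and `Π_w κ_w = K^S_ρ` off the walls while `D = 0` on them.
[cite: Rogawski1990, §4.9 p. 55; §14.6 p. 242] [cite: LanglandsShelstad1987, §2.4] -/
theorem archExplicitDelta_atlas_eq_mul (hS : ∀ w ∈ S, w ∈ splitChartPlaces L α)
    (ρ : {w : InfinitePlace L // IsComplex w} → Perm (Fin 3)) (hρ : ∀ w ∈ S, ρ w = 1) :
    archExplicitDelta L (Matrix.diagonal α) (endoTorus L S c) μ (gprimeTorus L α S fun v => c v ∘ ⇑(ρ v)) =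
      ((∏ w : {w : InfinitePlace L // IsComplex w},
          ((SignType.sign ((w.1.embedding (α (lineOf (formSign L α w) ((ρ w).symm 1)))).re) : ℤ) * archMajoritySign L (Matrix.diagonal α) w) : ℤ) : ℂ) *
        (archTau L (endoTorus L S c) μ * (archWeylRatio L (endoTorus L S c) : ℂ)) := by
  rw [archExplicitDelta_of_isArchNormPair L (Matrix.diagonal α) (endoTorus L S c) μ (isArchNormPair_endoTorus_gprimeTorus L α S c hS ρ hρ)]
  by_cases hall : ∀ w : {w : InfinitePlace L // IsComplex w},
      (((if w ∈ S then boostEig (c w) else fun i => (Circle.exp (c w i) : ℂ)) 1) - ((if w ∈ S then boostEig (c w) else fun i => (Circle.exp (c w i) : ℂ)) 0)) *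
        (((if w ∈ S then boostEig (c w) else fun i => (Circle.exp (c w i) : ℂ)) 1) - ((if w ∈ S then boostEig (c w) else fun i => (Circle.exp (c w i) : ℂ)) 2)) ≠ 0
  · rw [Finset.prod_congr rfl fun w _ => archKappaAt_atlas_eq_of_ne_zero L α c w hS ρ hρ (hall w)]
    ring
  · push Not at hall
    obtain ⟨w₀, hw₀⟩ := hall
    have hD : archWeylRatio L (endoTorus L S c) = 0 := by
      rw [archWeylRatio_endoTorus L S c]
      exact Finset.prod_eq_zero (Finset.mem_univ w₀) (by rw [hw₀, norm_zero])
    simp only [hD, Complex.ofReal_zero, mul_zero, zero_mul]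

variable {S} in
/-- **(I₁-Δ-S) — `Δ″` ON THE ATLAS IS THE COMPACT LAURENT POLYNOMIAL IN THE EIGENVALUE TRIPLE, TIMES THE CONSTANT `K^S_ρ`**, under the μ-guard: with PART 1's exponents `k_w`,
`Δ″(endoTorus S c, gprimeTorus α S (c∘ρ)) = K^S_ρ · Π_w [−(E_w0E_w2)^{k_w}·(E_w1 − E_w0)(E_w1 − E_w2)∕E_w1]` for every `S ⊆ splitChartPlaces`, every `ρ` (`= 1` on `S`), ALL `c` —
`δ_ρ(c)` of D2′-SPEC §3b in closed form: ENTIRE in the split coordinates, its sign constant on each chart. [cite: Rogawski1990, §8.2 p. 119; §4.9 p. 55; §14.6 p. 242] -/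
theorem exists_archExplicitDelta_atlas_eq_prod
    (hμω : ∀ x : ideleGroup ↥(maximalRealSubfield L), μ (AdeleRing.ideleBaseChange (↥(maximalRealSubfield L)) L x) = quadraticHeckeCharCM L x) :
    ∃ k : {w : InfinitePlace L // IsComplex w} → ℤ, ∀ (S : Finset {w : InfinitePlace L // IsComplex w}) (_hS : ∀ w ∈ S, w ∈ splitChartPlaces L α)
      (c : {w : InfinitePlace L // IsComplex w} → Fin 3 → ℝ) (ρ : {w : InfinitePlace L // IsComplex w} → Perm (Fin 3)) (_hρ : ∀ w ∈ S, ρ w = 1),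
      archExplicitDelta L (Matrix.diagonal α) (endoTorus L S c) μ (gprimeTorus L α S fun v => c v ∘ ⇑(ρ v)) =
        ((∏ w : {w : InfinitePlace L // IsComplex w},
            ((SignType.sign ((w.1.embedding (α (lineOf (formSign L α w) ((ρ w).symm 1)))).re) : ℤ) * archMajoritySign L (Matrix.diagonal α) w) : ℤ) : ℂ) *
          ∏ w : {w : InfinitePlace L // IsComplex w},
            -(((((if w ∈ S then boostEig (c w) else fun i => (Circle.exp (c w i) : ℂ)) 0) * ((if w ∈ S then boostEig (c w) else fun i => (Circle.exp (c w i) : ℂ)) 2)) ^ (k w)) *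
                ((((if w ∈ S then boostEig (c w) else fun i => (Circle.exp (c w i) : ℂ)) 1) - ((if w ∈ S then boostEig (c w) else fun i => (Circle.exp (c w i) : ℂ)) 0)) *
                  (((if w ∈ S then boostEig (c w) else fun i => (Circle.exp (c w i) : ℂ)) 1) - ((if w ∈ S then boostEig (c w) else fun i => (Circle.exp (c w i) : ℂ)) 2))) /
              ((if w ∈ S then boostEig (c w) else fun i => (Circle.exp (c w i) : ℂ)) 1)) := by
  obtain ⟨k, hk⟩ := exists_archTau_mul_archWeylRatio_endoTorus_eq L μ hμω
  exact ⟨k, fun S hS c ρ hρ => by rw [archExplicitDelta_atlas_eq_mul L α μ c hS ρ hρ, hk S c]⟩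

end Atlas

end Literature.NumberTheory.Rogawski1990

end
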